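import Literature.MathematicalPhysics.QuantumLattice.DWaveOrderParameterProofs
import Literature.MathematicalPhysics.QuantumLattice.HubbardTorus2DEnergyDensity
import Literature.MathematicalPhysics.QuantumLattice.DWaveSourceProofs
import Literature.MathematicalPhysics.QuantumLattice.LiebFluxPhaseProofs
import Summits.HubbardSuperconductivity.HubbardSuperconductivity.Theorems.ThermalWedgeTwSeededEnsembleEquivalenceRSourcedPressureLimit

/-!
# Stub `stub_sourcedEnergyDensityLimit` (D3a) of line `birth`
# (crux `BridgeNodalToDWave`, item stmt-HubbardSuperconductivity-10395, route NodalDiracTwist)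

**Statement.** For all real `U ≥ 0`, `μ`, `h ≥ 0` the ground-state energy density of the
`d`-wave-SOURCED grand-canonical Hubbard torus
`dWaveSourceTorus L U μ h = hubbardTorusWith 2 L 1 U μ − h (Δ_d + Δ_d†)` (`DWaveSource.lean`;
`Matrix.groundEnergy` = lowest eigenvalue, `FinDimSpectrum.lean`) has a thermodynamic limit:
`E₀(L+1)/(L+1)² → e` as `L → ∞` (the thermodynamic-limit hypothesis of the Koma–Tasaki forward leg
`stub_subsequenceOrderForcesSSB` of the skeleton). The hypotheses `0 ≤ U`, `0 ≤ h` are not used: the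
limit exists for all real `U, μ, h`.

**Proof (zero-temperature limit of the sourced pressure, uniformly in the volume).** The tree already
holds the thermodynamic limit of the SOURCED torus pressure at every inverse temperature `β > 0`
(`Theorems.stub_sourcedPressureLimit` of `…ThermalWedgeTwSeededEnsembleEquivalenceRSourcedPressureLimit`,
Ruelle's block/boundary argument for `H(G, w, μ) = hamiltonianWith − h(P_w + P_wᴴ)` with free and
periodic boundary conditions): `p_L(β) = log Re Z_β(H_L)/(βL²) → q(β)`. For a Hermitian `H` on a
`D`-dimensional space, `e^{-βE₀} ≤ Re Z_β ≤ D e^{-βE₀}` (`exp_neg_mul_groundEnergy_le_partitionFn`,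
`partitionFn_le_card_mul_exp`), and here `D = |𝒫(Orb Λ_L)| = 2^{2L²}` (`card_fock_fermionTorus_two`),
so the energy density `e_L = E₀(H_L)/L²` is sandwiched UNIFORMLY in `L`:
`-p_L(β) ≤ e_L ≤ -p_L(β) + 2 log 2/β` (`sourcedEnergyDensity_sandwich`). Given `ε > 0` choose `β`
with `2 log 2/β < ε/3` and then `L₀` with `|p_L(β) − q(β)| ≤ ε/3` for `L ≥ L₀`; then
`|e_m − e_n| < ε` for `m, n ≥ L₀`, i.e. `(e_L)` is Cauchy, hence convergent (`ℝ` complete). This is the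
standard "ground-state energy density = `β → ∞` limit of the free energy density, limits exchangeable by
the uniform `(log D)/(β|Λ|)` bound" (Ruelle 1969, §2.2 and §3.3–3.4), and it replaces the Fekete-along-
squares tiling of the canonical `HubbardTorus2DEnergyDensity.tendsto_groundEnergyAt_square_div_sq`
(the pair source breaks particle-number conservation but is a sum of bounded nearest-neighbour bond
terms, which is all the pressure limit uses).

Sources: D. Ruelle, *Statistical Mechanics: Rigorous Results* (1969), §2.2 (boundary terms of block
decompositions, independence of boundary conditions), §3.3–3.4 (thermodynamic limit of quantum lattice
systems; ground-state energy as the zero-temperature limit); T. Koma, H. Tasaki, J. Stat. Phys. 76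
(1994) 745, §1 (the symmetry-breaking source `H_Λ − h O_Λ`). No new definition; all statements proved
(`--supports stmt-HubbardSuperconductivity-10395`).
-/

-- the mandated namespace repeats `HubbardSuperconductivity` (single-problem summit, D-0017),
-- which the `dupNamespace` linter flags on every declaration
set_option linter.dupNamespace false

namespace Summit.HubbardSuperconductivity.HubbardSuperconductivity.Theorems.NodalDiracTwist.BridgeNodalToDWave

open Filter Matrix Literature.MathematicalPhysics.QuantumLattice Literature.Probability.LatticeModels
open scoped Topology ComplexOrder

/-- **Dimension of the Fock space of the torus `(ℤ/Lℤ)²`**: `|𝒫(Orb Λ_L)| = 2^{2L²}`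
(`|Λ_L| = L²` sites, two spin orbitals per site). [folklore] -/
theorem card_fock_fermionTorus_two (L : ℕ) :
    Fintype.card (Finset (Orb (FermionTorus 2 L))) = 2 ^ (2 * L ^ 2) := by
  rw [Fintype.card_finset, card_orb, Fintype.card_lex, Fintype.card_fun, Fintype.card_fin,
    Fintype.card_fin]

/-- **Zero-temperature sandwich for the sourced torus, uniform in the volume.** For `L ≥ 1`, `β > 0`
and all real `U, μ, h`, with `p = log Re Z_β(H_{L,h})/(βL²)` and `e = E₀(H_{L,h})/L²`:
`-p ≤ e ≤ -p + 2 log 2/β` (from `e^{-βE₀} ≤ Re Z_β ≤ 2^{2L²} e^{-βE₀}`).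
(Ruelle 1969, §3.4: the ground-state energy density is the `β → ∞` limit of the free energy density,
with an error `≤ (log D)/(β|Λ|)` uniform in `Λ`.) [cite: Ruelle1969, §3.4] -/
theorem sourcedEnergyDensity_sandwich (L : ℕ) [NeZero L] (U μ h : ℝ) {β : ℝ} (hβ : 0 < β) :
    -(Real.log (Matrix.partitionFn β (dWaveSourceTorus L U μ h)).re / (β * (L : ℝ) ^ 2)) ≤
        (dWaveSourceTorus L U μ h).groundEnergy / (L : ℝ) ^ 2 ∧
      (dWaveSourceTorus L U μ h).groundEnergy / (L : ℝ) ^ 2 ≤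
        -(Real.log (Matrix.partitionFn β (dWaveSourceTorus L U μ h)).re / (β * (L : ℝ) ^ 2)) +
          2 * Real.log 2 / β := by
  have hH : (dWaveSourceTorus L U μ h).IsHermitian :=
    dWaveSourceTorus_isHermitian L (isHermitian_hubbardTorusWith L 1 U μ) h
  set E : ℝ := (dWaveSourceTorus L U μ h).groundEnergy with hE
  set Z : ℝ := (Matrix.partitionFn β (dWaveSourceTorus L U μ h)).re with hZ
  have h1 : Real.exp (-(β * E)) ≤ Z := exp_neg_mul_groundEnergy_le_partitionFn hH β
  have h2 : Z ≤ Fintype.card (Finset (Orb (FermionTorus 2 L))) * Real.exp (-(β * E)) :=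
    partitionFn_le_card_mul_exp hH hβ.le
  have hZpos : 0 < Z := lt_of_lt_of_le (Real.exp_pos _) h1
  have hL2 : (0 : ℝ) < (L : ℝ) ^ 2 := cast_sq_pos_of_neZero L
  -- `-βE ≤ log Z ≤ 2L² log 2 - βE`
  have hlog1 : -(β * E) ≤ Real.log Z := by
    have := Real.log_le_log (Real.exp_pos _) h1
    rwa [Real.log_exp] at this
  have hcard : (Fintype.card (Finset (Orb (FermionTorus 2 L))) : ℝ) = 2 ^ (2 * L ^ 2) := by
    rw [card_fock_fermionTorus_two]; push_cast; ring
  have hlog2 : Real.log Z ≤ 2 * (L : ℝ) ^ 2 * Real.log 2 - β * E := by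
    have hD : (0 : ℝ) < 2 ^ (2 * L ^ 2) := by positivity
    have := Real.log_le_log hZpos h2
    rw [hcard, Real.log_mul hD.ne' (Real.exp_pos _).ne', Real.log_exp, Real.log_pow] at this
    push_cast at this
    linarith
  have hβL : (0 : ℝ) < β * (L : ℝ) ^ 2 := mul_pos hβ hL2
  constructor
  · -- `e + p = (βE + log Z)/(βL²) ≥ 0`
    have key : 0 ≤ (β * E + Real.log Z) / (β * (L : ℝ) ^ 2) := div_nonneg (by linarith) hβL.le
    have eq : (β * E + Real.log Z) / (β * (L : ℝ) ^ 2) =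
        E / (L : ℝ) ^ 2 + Real.log Z / (β * (L : ℝ) ^ 2) := by
      field_simp
    rw [eq] at key
    linarith
  · -- `-p + 2 log 2/β - e = (2L² log 2 - βE - log Z)/(βL²) ≥ 0`
    have key : 0 ≤ (2 * (L : ℝ) ^ 2 * Real.log 2 - β * E - Real.log Z) / (β * (L : ℝ) ^ 2) :=
      div_nonneg (by linarith) hβL.le
    have eq : (2 * (L : ℝ) ^ 2 * Real.log 2 - β * E - Real.log Z) / (β * (L : ℝ) ^ 2) =
        2 * Real.log 2 / β - E / (L : ℝ) ^ 2 - Real.log Z / (β * (L : ℝ) ^ 2) := by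
      rw [div_sub_div _ _ hβ.ne' hL2.ne', div_sub_div _ _ (mul_ne_zero hβ.ne' hL2.ne') hβL.ne',
        div_eq_div_iff hβL.ne' (mul_ne_zero (mul_ne_zero hβ.ne' hL2.ne') hβL.ne')]
      ring
    rw [eq] at key
    linarith

/-- **D3a. Thermodynamic limit of the ground-state energy density of the `d`-wave-sourced
grand-canonical Hubbard torus** (registered stub `stub_sourcedEnergyDensityLimit` of line `birth`): for
all real `U ≥ 0`, `μ`, `h ≥ 0`, `E₀(dWaveSourceTorus (L+1) U μ h)/(L+1)²` converges as `L → ∞`.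
Proof: the sequence is Cauchy — by `sourcedEnergyDensity_sandwich` it lies within `2 log 2/β` of
minus the sourced torus pressure density at inverse temperature `β`, which converges as `L → ∞` for every
`β > 0` (`Theorems.stub_sourcedPressureLimit`); take `β → ∞`. (Ruelle, *Statistical Mechanics* (1969),
§2.2, §3.3–3.4; Koma–Tasaki, J. Stat. Phys. 76 (1994) 745, §1 for the sourced Hamiltonian.)
[cite: Ruelle1969, §3.3] -/
theorem stub_sourcedEnergyDensityLimit : ∀ (U μ h : ℝ), 0 ≤ U → 0 ≤ h → ∃ e : ℝ, Filter.Tendsto (fun L : ℕ =>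
      (Literature.MathematicalPhysics.QuantumLattice.dWaveSourceTorus (L + 1) U μ h).groundEnergy /
        ((L + 1 : ℕ) : ℝ) ^ 2) Filter.atTop (nhds e) := by
  intro U μ h _hU _hh
  -- the sequence of energy densities is Cauchy
  have hC : CauchySeq (fun L : ℕ =>
      (dWaveSourceTorus (L + 1) U μ h).groundEnergy / ((L + 1 : ℕ) : ℝ) ^ 2) := by
    refine Metric.cauchySeq_iff.2 fun ε hε => ?_
    -- an inverse temperature with `2 log 2 / β < ε / 3`
    obtain ⟨β, hβ, hβε⟩ : ∃ β : ℝ, 0 < β ∧ 2 * Real.log 2 / β < ε / 3 := by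
      have hl2 : 0 < Real.log 2 := Real.log_pos one_lt_two
      refine ⟨6 * Real.log 2 / ε + 1, by positivity, ?_⟩
      rw [div_lt_iff₀ (by positivity)]
      have : ε / 3 * (6 * Real.log 2 / ε + 1) = 2 * Real.log 2 + ε / 3 := by
        field_simp
        ring
      rw [this]
      linarith
    -- the sourced pressure density converges at this `β`
    obtain ⟨q, hq⟩ := Theorems.stub_sourcedPressureLimit β U μ h hβ
    obtain ⟨L₀, hL₀⟩ := hq (ε / 3) (by positivity)
    refine ⟨L₀, fun m hm n hn => ?_⟩
    have hpm := hL₀ (m + 1) (by omega)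
    have hpn := hL₀ (n + 1) (by omega)
    obtain ⟨hm1, hm2⟩ := sourcedEnergyDensity_sandwich (m + 1) U μ h hβ
    obtain ⟨hn1, hn2⟩ := sourcedEnergyDensity_sandwich (n + 1) U μ h hβ
    rw [abs_le] at hpm hpn
    rw [Real.dist_eq, abs_sub_lt_iff]
    constructor <;> linarith
  exact cauchySeq_tendsto_of_complete hC

end Summit.HubbardSuperconductivity.HubbardSuperconductivity.Theorems.NodalDiracTwist.BridgeNodalToDWave
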